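import Mathlib
import Literature.Computability.AlgebraicComplexity.RazUniversalCircuits
import Literature.Computability.AlgebraicComplexity.ArithCircuitProofs
import Literature.Computability.AlgebraicComplexity.IMMInVPProofs
import Literature.Barriers.ValiantsHypothesis.AlgebraicNaturalProofs
import Summits.ValiantsHypothesis.ValiantsHypothesis.Theorems.BarrierLeverDefinableEquationsDefs

/-!
# Raz's universal circuit-graph: `OUT(y)` has degree `≤ r` and POLYNOMIAL circuit complexity for
# every labelling `y`; hence every Raz point is the top of a small circuit (lead c6, crux 8745)

The universality of `RazUniversal.outVal y` (Raz 2010, Prop. 2.8 / §3.2) is in the tree; the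
converse bookkeeping — `outVal y` is itself cheap in the tree's measure `complexity` — is not.

* `RazImage.totalDegree_outVal_le` — `deg OUT(y) ≤ r` (level-`d` nodes have degree `≤ d`;
  induction along the recursion of `RazUniversal.base`);
* `RazImage.complexity_outVal_le` — `L(OUT(y)) ≤ 2B + (r+1)·B·(4B+1)`, `B = #σ + rN` (Raz:
  "Size(G) = O(s'² r⁸)"; here only "polynomial"), by ITERATED SUBSTITUTION as in
  `complexity_immPoly_le` (one variable per node; substitute level by level downwards);
* `outVal_mem_smallCircuits` (registered sub-goal) — for `n ≥ 64`, every `outVal y` with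
  `razSlots n b` slots lies in `SmallCircuits ℂ n (2b+9)`: every Raz point is the top-coefficient
  vector of a small circuit (so, file `…RazAnnihilatorsIff.lean`, the registered stub of line
  `registered` is EQUIVALENT to the crux).

No definitions (the bookkeeping polynomials are local to the proof), no facts.
-/

set_option linter.dupNamespace false

noncomputable section

namespace Summit.ValiantsHypothesis.ValiantsHypothesis.Theorems.BarrierLeverDefinableEquations

namespace RazImage

open MvPolynomial Literature.Computability.AlgebraicComplexity RazUniversal
open scoped BigOperators

universe v

variable {σ : Type v} [Fintype σ] {r N : ℕ}

/-! ## §1 Degree: level-`d` nodes compute polynomials of degree `≤ d` -/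

/-- The node `b` of level `d` computes a polynomial of total degree `≤ d`.
[cite: Raz2010, Prop. 2.8 (p. 154)] -/
theorem totalDegree_baseVal_le (y : Lab σ r N → ℂ) :
    ∀ (m : ℕ) (d : Fin (r + 1)), (d : ℕ) = m → ∀ b : BIdx σ r N, (baseVal y d b).totalDegree ≤ m := by
  intro m
  induction m using Nat.strong_induction_on with
  | _ m ih =>
    rintro d rfl b
    rcases b with t | ⟨j, kk⟩
    · rw [baseVal_inl]
      split_ifs with h
      · rw [h]; exact (totalDegree_X (R := ℂ) t).le
      · rw [totalDegree_zero]; exact Nat.zero_le _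
    · by_cases h : 1 ≤ (j : ℕ) ∧ (j : ℕ) < (d : ℕ)
      · rw [baseVal_inr y d j kk h]
        refine (totalDegree_mul _ _).trans ?_
        have h1 : (∑ b : BIdx σ r N, y (Sum.inl (d, j, kk, false, b)) • baseVal y (Fin.castSucc j) b).totalDegree
            ≤ (j : ℕ) :=
          totalDegree_finsetSum_le fun b _ =>
            (totalDegree_smul_le _ _).trans (ih (j : ℕ) h.2 (Fin.castSucc j) rfl b)
        have h2 : (∑ b : BIdx σ r N, y (Sum.inl (d, j, kk, true, b)) •
              baseVal y ⟨(d : ℕ) - j, by have := d.isLt; omega⟩ b).totalDegree ≤ (d : ℕ) - j :=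
          totalDegree_finsetSum_le fun b _ =>
            (totalDegree_smul_le _ _).trans
              (ih ((d : ℕ) - j) (by omega) ⟨(d : ℕ) - j, by have := d.isLt; omega⟩ rfl b)
        omega
      · rw [baseVal_inr_of_not y d j kk h, totalDegree_zero]
        exact Nat.zero_le _

/-- **`deg OUT(y) ≤ r`**: the output gate is a weighted sum of level-`r` nodes.
[cite: Raz2010, Prop. 2.8 (p. 154)] -/
theorem totalDegree_outVal_le (y : Lab σ r N → ℂ) : (outVal y).totalDegree ≤ r := by
  rw [outVal_eq]
  exact totalDegree_finsetSum_le fun b _ =>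
    (totalDegree_smul_le _ _).trans (totalDegree_baseVal_le y r (Fin.last r) rfl b)

/-! ## §2 Complexity: iterated substitution, level by level -/

/-- **`L(OUT(y)) ≤ 2B + (r+1)·B·(4B+1)`**, `B = #σ + rN` the number of node indices per level:
the universal circuit has polynomial size in the tree's measure `complexity`.  Iterated
substitution: one variable per node `(d, b)`; start from the output gate `∑_b y_b X_{(r,b)}` and
substitute, for `d = r, r-1, …, 0`, every level-`d` node variable by its defining expression in
lower-level node variables (`baseVal_inl` / `baseVal_inr`); each level costs `≤ B(4B+1)` by
`complexity_aeval_le`, the semantics is unchanged, and at the end no node variable is left.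
[cite: Raz2010, Prop. 2.8 (p. 155)] -/
theorem complexity_outVal_le (y : Lab σ r N → ℂ) :
    complexity (outVal y) ≤ 2 * Fintype.card (BIdx σ r N) +
      (r + 1) * (Fintype.card (BIdx σ r N) * (4 * Fintype.card (BIdx σ r N) + 1)) := by
  classical
  set B := Fintype.card (BIdx σ r N) with hB
  set K := B * (4 * B + 1) with hK
  have hX : ∀ v : σ ⊕ (Fin (r + 1) × BIdx σ r N),
      complexity (X v : MvPolynomial (σ ⊕ (Fin (r + 1) × BIdx σ r N)) ℂ) = 0 := complexity_X_holds
  have hC : ∀ c : ℂ, complexity (C c : MvPolynomial (σ ⊕ (Fin (r + 1) × BIdx σ r N)) ℂ) = 0 :=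
    complexity_C_holds
  have h0 : complexity (0 : MvPolynomial (σ ⊕ (Fin (r + 1) × BIdx σ r N)) ℂ) = 0 := by
    have := hC 0; rwa [map_zero] at this
  have hsum : ∀ (c : BIdx σ r N → ℂ) (v : BIdx σ r N → σ ⊕ (Fin (r + 1) × BIdx σ r N)),
      complexity (∑ b' : BIdx σ r N, C (c b') * X (v b') :
        MvPolynomial (σ ⊕ (Fin (r + 1) × BIdx σ r N)) ℂ) ≤ 2 * B := by
    intro c v
    calc complexity (∑ b' : BIdx σ r N, C (c b') * X (v b'))
        ≤ ∑ b' : BIdx σ r N, complexity (C (c b') * X (v b') :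
            MvPolynomial (σ ⊕ (Fin (r + 1) × BIdx σ r N)) ℂ) +
            (Finset.univ : Finset (BIdx σ r N)).card := complexity_finset_sum_le _ _
      _ ≤ ∑ _b' : BIdx σ r N, 1 + (Finset.univ : Finset (BIdx σ r N)).card := by
          gcongr with b'
          calc complexity (C (c b') * X (v b') : MvPolynomial (σ ⊕ (Fin (r + 1) × BIdx σ r N)) ℂ)
              ≤ complexity (C (c b') : MvPolynomial (σ ⊕ (Fin (r + 1) × BIdx σ r N)) ℂ) +
                  complexity (X (v b') : MvPolynomial (σ ⊕ (Fin (r + 1) × BIdx σ r N)) ℂ) + 1 :=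
                complexity_mul_le_holds _ _
            _ = 1 := by rw [hC, hX]
      _ = 2 * B := by
          rw [Finset.sum_const, Finset.card_univ, smul_eq_mul, mul_one, hB]; ring
  -- the defining expression of node `b` at level `d` (mirrors `baseVal_inl` / `baseVal_inr`)
  obtain ⟨nodeDef, hnd_inl, hnd_inr⟩ :
      ∃ f : Fin (r + 1) → BIdx σ r N → MvPolynomial (σ ⊕ (Fin (r + 1) × BIdx σ r N)) ℂ,
        (∀ d t, f d (Sum.inl t) = if (d : ℕ) = 1 then X (Sum.inl t) else 0) ∧
        ∀ d j kk, f d (Sum.inr (j, kk)) =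
          if h : 1 ≤ (j : ℕ) ∧ (j : ℕ) < (d : ℕ) then
            (∑ b : BIdx σ r N, C (y (Sum.inl (d, j, kk, false, b))) * X (Sum.inr (Fin.castSucc j, b))) *
              (∑ b : BIdx σ r N, C (y (Sum.inl (d, j, kk, true, b))) *
                X (Sum.inr (⟨(d : ℕ) - j, lt_of_le_of_lt (Nat.sub_le _ _) d.isLt⟩, b)))
          else 0 := by
    refine ⟨fun d b => Sum.elim (fun t => if (d : ℕ) = 1 then X (Sum.inl t) else 0)
        (fun jk => if h : 1 ≤ (jk.1 : ℕ) ∧ (jk.1 : ℕ) < (d : ℕ) then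
            (∑ b : BIdx σ r N, C (y (Sum.inl (d, jk.1, jk.2, false, b))) *
                X (Sum.inr (Fin.castSucc jk.1, b))) *
              (∑ b : BIdx σ r N, C (y (Sum.inl (d, jk.1, jk.2, true, b))) *
                X (Sum.inr (⟨(d : ℕ) - jk.1, lt_of_le_of_lt (Nat.sub_le _ _) d.isLt⟩, b)))
          else 0) b, ?_, ?_⟩
    · intro d t; rfl
    · intro d j kk
      simp only [Sum.elim_inr]
  -- the semantics of node variables
  obtain ⟨sem, hsem_inl, hsem_inr⟩ :
      ∃ g : σ ⊕ (Fin (r + 1) × BIdx σ r N) → MvPolynomial σ ℂ,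
        (∀ t, g (Sum.inl t) = X t) ∧ ∀ e b, g (Sum.inr (e, b)) = baseVal y e b := by
    refine ⟨fun v => Sum.elim X (fun eb => baseVal y eb.1 eb.2) v, ?_, ?_⟩
    · intro t; rfl
    · intro e b; rfl
  -- (i) the defining expressions are semantically correct
  have hsem_nodeDef : ∀ (d : Fin (r + 1)) (b : BIdx σ r N), aeval sem (nodeDef d b) = baseVal y d b := by
    intro d b
    rcases b with t | ⟨j, kk⟩
    · rw [hnd_inl, baseVal_inl]
      split_ifs <;> simp [hsem_inl]
    · by_cases h : 1 ≤ (j : ℕ) ∧ (j : ℕ) < (d : ℕ)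
      · rw [hnd_inr, dif_pos h, map_mul, map_sum, map_sum, baseVal_inr y d j kk h]
        simp only [map_mul, aeval_C, aeval_X, algebraMap_eq, hsem_inr, smul_eq_C_mul]
      · rw [hnd_inr, dif_neg h, map_zero, baseVal_inr_of_not y d j kk h]
  -- (ii) they mention only node variables of lower level
  have hvars_nodeDef : ∀ (d : Fin (r + 1)) (b : BIdx σ r N), ∀ v ∈ (nodeDef d b).vars, ∀ (e : Fin (r + 1)) (b' : BIdx σ r N),
      v = Sum.inr (e, b') → (e : ℕ) < (d : ℕ) := by
    intro d b v hv e b' hve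
    subst hve
    rcases b with t | ⟨j, kk⟩
    · rw [hnd_inl] at hv
      split_ifs at hv with h
      · rw [vars_X] at hv
        simp at hv
      · simp at hv
    · rw [hnd_inr] at hv
      split_ifs at hv with h
      · have hv' := vars_mul _ _ hv
        rw [Finset.mem_union] at hv'
        have key : ∀ (c : BIdx σ r N → ℂ) (e₀ : Fin (r + 1)),
            Sum.inr (e, b') ∈ (∑ b'' : BIdx σ r N, C (c b'') * X (Sum.inr (e₀, b'')) :
              MvPolynomial (σ ⊕ (Fin (r + 1) × BIdx σ r N)) ℂ).vars → e = e₀ := by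
          intro c e₀ hm
          have h1 := vars_sum_subset _ _ hm
          rw [Finset.mem_biUnion] at h1
          obtain ⟨b'', -, hb''⟩ := h1
          have h2 := vars_mul _ _ hb''
          rw [vars_C, Finset.empty_union, vars_X, Finset.mem_singleton] at h2
          cases h2
          rfl
        rcases hv' with hv' | hv'
        · rw [key _ _ hv', Fin.val_castSucc]
          exact h.2
        · rw [key _ _ hv']
          show (d : ℕ) - j < d
          omega
      · simp at hv
  -- (iii) they are cheap
  have hcx_nodeDef : ∀ (d : Fin (r + 1)) (b : BIdx σ r N), complexity (nodeDef d b) ≤ 4 * B + 1 := by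
    intro d b
    rcases b with t | ⟨j, kk⟩
    · rw [hnd_inl]
      split_ifs
      · rw [hX]; exact Nat.zero_le _
      · rw [h0]; exact Nat.zero_le _
    · rw [hnd_inr]
      split_ifs
      · refine (complexity_mul_le_holds _ _).trans ?_
        have h1 := hsum (fun b' => y (Sum.inl (d, j, kk, false, b'))) (fun b' => Sum.inr (Fin.castSucc j, b'))
        have h2 := hsum (fun b' => y (Sum.inl (d, j, kk, true, b')))
          (fun b' => Sum.inr (⟨(d : ℕ) - j, lt_of_le_of_lt (Nat.sub_le _ _) d.isLt⟩, b'))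
        omega
      · rw [h0]; exact Nat.zero_le _
  -- the level-`d` substitution
  obtain ⟨subst, hsub_inl, hsub_inr⟩ :
      ∃ s : Fin (r + 1) → σ ⊕ (Fin (r + 1) × BIdx σ r N) →
          MvPolynomial (σ ⊕ (Fin (r + 1) × BIdx σ r N)) ℂ,
        (∀ d t, s d (Sum.inl t) = X (Sum.inl t)) ∧
        ∀ d e b, s d (Sum.inr (e, b)) = if e = d then nodeDef d b else X (Sum.inr (e, b)) := by
    refine ⟨fun d v => Sum.elim (fun t => X (Sum.inl t))
        (fun eb => if eb.1 = d then nodeDef d eb.2 else X (Sum.inr (eb.1, eb.2))) v, ?_, ?_⟩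
    · intro d t; rfl
    · intro d e b; rfl
  -- (iv) one substitution step: semantics, variables, cost
  have hstep_sem : ∀ (d : Fin (r + 1)) (p : MvPolynomial (σ ⊕ (Fin (r + 1) × BIdx σ r N)) ℂ),
      aeval sem (aeval (subst d) p) = aeval sem p := by
    intro d p
    have h : (fun v : σ ⊕ (Fin (r + 1) × BIdx σ r N) =>
        (aeval sem : MvPolynomial (σ ⊕ (Fin (r + 1) × BIdx σ r N)) ℂ →ₐ[ℂ] MvPolynomial σ ℂ)
          (subst d v)) = sem := by
      funext v
      rcases v with t | ⟨e, b⟩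
      · rw [hsub_inl, aeval_X]
      · rw [hsub_inr]
        split_ifs with h
        · subst h; rw [hsem_nodeDef, hsem_inr]
        · rw [aeval_X]
    rw [← AlgHom.comp_apply, MvPolynomial.comp_aeval, h]
  have hstep_vars : ∀ (d : Fin (r + 1)) (p : MvPolynomial (σ ⊕ (Fin (r + 1) × BIdx σ r N)) ℂ),
      (∀ v ∈ p.vars, ∀ (e : Fin (r + 1)) (b : BIdx σ r N), v = Sum.inr (e, b) → (e : ℕ) < (d : ℕ) + 1) →
      ∀ v ∈ (aeval (subst d) p).vars, ∀ (e : Fin (r + 1)) (b : BIdx σ r N),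
        v = Sum.inr (e, b) → (e : ℕ) < (d : ℕ) := by
    intro d p hp v hv e b hve
    rw [aeval_eq_bind₁] at hv
    obtain ⟨w, hw, hvw⟩ := mem_vars_bind₁ _ _ hv
    rcases w with t | ⟨e', b'⟩
    · rw [hsub_inl, vars_X, Finset.mem_singleton] at hvw
      rw [hvw] at hve
      cases hve
    · rw [hsub_inr] at hvw
      split_ifs at hvw with h
      · exact hvars_nodeDef d b' v hvw e b hve
      · rw [vars_X, Finset.mem_singleton] at hvw
        have h1 := hp _ hw e' b' rfl
        have h2 : (e' : ℕ) ≠ (d : ℕ) := fun h' => h (Fin.ext h')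
        rw [hvw] at hve
        cases hve
        omega
  have hstep_cx : ∀ (d : Fin (r + 1)) (p : MvPolynomial (σ ⊕ (Fin (r + 1) × BIdx σ r N)) ℂ),
      complexity (aeval (subst d) p) ≤ complexity p + K := by
    intro d p
    refine (complexity_aeval_le _ _).trans (Nat.add_le_add_left ?_ _)
    rw [Fintype.sum_sum_type]
    simp only [hsub_inl, hX, Finset.sum_const_zero, zero_add]
    rw [Fintype.sum_prod_type]
    calc ∑ e : Fin (r + 1), ∑ b : BIdx σ r N, complexity (subst d (Sum.inr (e, b)))
        = ∑ b : BIdx σ r N, complexity (nodeDef d b) := by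
          rw [Finset.sum_eq_single d]
          · simp [hsub_inr]
          · intro e _ hed
            simp [hsub_inr, hed, hX]
          · intro hd; exact absurd (Finset.mem_univ d) hd
      _ ≤ ∑ _b : BIdx σ r N, (4 * B + 1) := Finset.sum_le_sum fun b _ => hcx_nodeDef d b
      _ = K := by rw [Finset.sum_const, Finset.card_univ, smul_eq_mul, hK, hB]
  -- the output gate as a polynomial in the level-`r` node variables
  set P : MvPolynomial (σ ⊕ (Fin (r + 1) × BIdx σ r N)) ℂ :=
    ∑ b : BIdx σ r N, C (y (Sum.inr b)) * X (Sum.inr (Fin.last r, b)) with hP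
  have hP_sem : aeval sem P = outVal y := by
    rw [outVal_eq, hP, map_sum]
    refine Finset.sum_congr rfl fun b _ => ?_
    rw [map_mul, aeval_C, aeval_X, algebraMap_eq, smul_eq_C_mul, hsem_inr]
  have hP_vars : ∀ v ∈ P.vars, ∀ (e : Fin (r + 1)) (b : BIdx σ r N), v = Sum.inr (e, b) → (e : ℕ) < r + 1 :=
    fun v _ e b _ => e.isLt
  have hP_cx : complexity P ≤ 2 * B := hsum (fun b => y (Sum.inr b)) (fun b => Sum.inr (Fin.last r, b))
  obtain ⟨iter, hiter0, hiterS⟩ :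
      ∃ I : ℕ → MvPolynomial (σ ⊕ (Fin (r + 1) × BIdx σ r N)) ℂ, I 0 = P ∧
        ∀ i, I (i + 1) = if h : i ≤ r then aeval (subst ⟨r - i, Nat.lt_succ_of_le (Nat.sub_le r i)⟩) (I i) else I i := by
    refine ⟨fun i => Nat.rec P (fun i acc => if h : i ≤ r then aeval (subst ⟨r - i, Nat.lt_succ_of_le (Nat.sub_le r i)⟩) acc else acc) i,
      ?_, ?_⟩
    · rfl
    · intro i; rfl
  have hinv : ∀ i, aeval sem (iter i) = outVal y ∧
      (∀ v ∈ (iter i).vars, ∀ (e : Fin (r + 1)) (b : BIdx σ r N), v = Sum.inr (e, b) → (e : ℕ) < r + 1 - i) ∧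
      complexity (iter i) ≤ 2 * B + i * K := by
    intro i
    induction i with
    | zero =>
      refine ⟨by rw [hiter0, hP_sem], ?_, by rw [hiter0]; simpa using hP_cx⟩
      intro v hv e b hve
      rw [hiter0] at hv
      have := hP_vars v hv e b hve
      omega
    | succ i ih =>
      obtain ⟨hs, hv, hc⟩ := ih
      rw [hiterS]
      split_ifs with h
      · refine ⟨by rw [hstep_sem, hs], ?_, ?_⟩
        · have hv' : ∀ v ∈ (iter i).vars, ∀ (e : Fin (r + 1)) (b : BIdx σ r N), v = Sum.inr (e, b) →
              (e : ℕ) < (((⟨r - i, Nat.lt_succ_of_le (Nat.sub_le r i)⟩ : Fin (r + 1)) : ℕ)) + 1 := by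
            intro v hv1 e b hve
            have := hv v hv1 e b hve
            show (e : ℕ) < r - i + 1
            omega
          intro v hv1 e b hve
          have := hstep_vars ⟨r - i, Nat.lt_succ_of_le (Nat.sub_le r i)⟩ (iter i) hv' v hv1 e b hve
          change (e : ℕ) < r - i at this
          omega
        · calc complexity (aeval (subst ⟨r - i, Nat.lt_succ_of_le (Nat.sub_le r i)⟩) (iter i)) ≤ complexity (iter i) + K :=
                hstep_cx _ _
            _ ≤ (2 * B + i * K) + K := Nat.add_le_add_right hc _
            _ = 2 * B + (i + 1) * K := by ring
      · refine ⟨hs, ?_, hc.trans (by gcongr; omega)⟩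
        have h2 : r + 1 - (i + 1) = r + 1 - i := by omega
        rw [h2]; exact hv
  -- after `r + 1` steps no node variable is left: the semantics is a free substitution
  obtain ⟨hs, hv, hc⟩ := hinv (r + 1)
  let sem₀ : σ ⊕ (Fin (r + 1) × BIdx σ r N) → MvPolynomial σ ℂ := Sum.elim X fun _ => 0
  have hfree : aeval sem (iter (r + 1)) = aeval sem₀ (iter (r + 1)) := by
    change (aeval sem : MvPolynomial (σ ⊕ (Fin (r + 1) × BIdx σ r N)) ℂ →ₐ[ℂ] MvPolynomial σ ℂ).toRingHom
        (iter (r + 1)) =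
      (aeval sem₀ : MvPolynomial (σ ⊕ (Fin (r + 1) × BIdx σ r N)) ℂ →ₐ[ℂ] MvPolynomial σ ℂ).toRingHom
        (iter (r + 1))
    refine hom_congr_vars ?_ (fun v hv1 _ => ?_) rfl
    · ext c
      simp
    · rcases v with t | ⟨e, b⟩
      · simp [hsem_inl, sem₀]
      · exact absurd (hv _ hv1 e b rfl) (by omega)
  have hXσ : ∀ t : σ, complexity (X t : MvPolynomial σ ℂ) = 0 := complexity_X_holds
  have h0σ : complexity (0 : MvPolynomial σ ℂ) = 0 := by
    have := complexity_C_holds (σ := σ) (0 : ℂ); rwa [map_zero] at this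
  rw [← hs, hfree]
  refine (complexity_aeval_le _ _).trans ?_
  rw [Fintype.sum_sum_type]
  simp only [sem₀, Sum.elim_inl, Sum.elim_inr, hXσ, h0σ, Finset.sum_const_zero, add_zero]
  rw [hK, hB] at hc
  exact hc

end RazImage

/-! ## §3 Raz points are tops of small circuits -/

open MvPolynomial Literature.Computability.AlgebraicComplexity Literature.Barriers.ValiantsHypothesis in
/-- Arithmetic: with `B ≤ 17 n^(b+3)` node indices, `2B + (n+1) B (4B+1) ≤ n^(2b+9)` for `n ≥ 64`.
[folklore] -/
theorem RazImage.size_arith {n b B : ℕ} (hn : 64 ≤ n) (hB : B ≤ 17 * n ^ (b + 3)) :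
    2 * B + (n + 1) * (B * (4 * B + 1)) ≤ n ^ (2 * b + 9) := by
  have hB1 : 4 * B + 1 ≤ 5 * (17 * n ^ (b + 3)) := by
    have : 1 ≤ n ^ (b + 3) := Nat.one_le_pow _ _ (by omega)
    omega
  calc 2 * B + (n + 1) * (B * (4 * B + 1))
      ≤ 2 * (17 * n ^ (b + 3)) + (2 * n) * ((17 * n ^ (b + 3)) * (5 * (17 * n ^ (b + 3)))) := by
        gcongr; omega
    _ = 34 * n ^ (b + 3) + 2890 * (n * (n ^ (b + 3) * n ^ (b + 3))) := by ring
    _ ≤ 34 * (n * (n ^ (b + 3) * n ^ (b + 3))) + 2890 * (n * (n ^ (b + 3) * n ^ (b + 3))) := by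
        gcongr
        calc n ^ (b + 3) = 1 * (n ^ (b + 3) * 1) := by ring
          _ ≤ n * (n ^ (b + 3) * n ^ (b + 3)) := by
              gcongr
              · omega
              · exact Nat.one_le_pow _ _ (by omega)
    _ = 2924 * n ^ (2 * b + 7) := by ring
    _ ≤ (n * n) * n ^ (2 * b + 7) := Nat.mul_le_mul_right _ (by nlinarith)
    _ = n ^ (2 * b + 9) := by ring

open MvPolynomial Literature.Computability.AlgebraicComplexity Literature.Barriers.ValiantsHypothesis in
/-- **Raz points are tops of small circuits** (`n ≥ 64`): the output `OUT(y)` of the universal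
circuit-graph with `razSlots n b = 4 n^b (n+1)²` slots has degree `≤ n` and complexity
`≤ n^(2b+9)`, i.e. lies in `SmallCircuits ℂ n (2b+9)`; its top coefficients are `razPoint n b y`
(`RazUniversal.coeff_outVal`). [cite: Raz2010, Prop. 2.8 (p. 155)] -/
theorem RazImage.outVal_mem {b n : ℕ} (hn : 64 ≤ n) (y : RazUniversal.Lab (Fin n) n (razSlots n b) → ℂ) :
    RazUniversal.outVal y ∈ SmallCircuits ℂ n (2 * b + 9) := by
  refine ⟨RazImage.totalDegree_outVal_le y, (RazImage.complexity_outVal_le y).trans ?_⟩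
  refine RazImage.size_arith hn ?_
  -- `#BIdx = n + n · 4 n^b (n+1)² ≤ 17 n^(b+3)`
  simp only [RazUniversal.BIdx, Fintype.card_sum, Fintype.card_prod, Fintype.card_fin]
  simp only [razSlots]
  have h1 : (n + 1) ^ 2 ≤ 4 * n ^ 2 := by nlinarith
  have hpos : 1 ≤ n ^ b := Nat.one_le_pow _ _ (by omega)
  have hnn : 1 ≤ n * n := by nlinarith
  calc n + n * (4 * n ^ b * (n + 1) ^ 2) ≤ n + n * (4 * n ^ b * (4 * n ^ 2)) := by gcongr
    _ = n + 16 * n ^ (b + 3) := by ring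
    _ ≤ n ^ (b + 3) + 16 * n ^ (b + 3) := by
        gcongr
        calc n = n * 1 * 1 := by ring
          _ ≤ n * n ^ b * (n * n) := by gcongr
          _ = n ^ (b + 3) := by ring
    _ = 17 * n ^ (b + 3) := by ring

/-- **Registered sub-goal `outVal_mem_smallCircuits` (verbatim signature).**  Every output of Raz's
universal circuit-graph with `razSlots n b` slots is a member of `SmallCircuits ℂ n (2b+9)`
(`n ≥ 64`; `RazImage.outVal_mem`). [cite: Raz2010, Prop. 2.8 (p. 155)] -/
theorem outVal_mem_smallCircuits : ∀ b n : ℕ, 64 ≤ n → ∀ y : Literature.Computability.AlgebraicComplexity.RazUniversal.Lab (Fin n) n (Summit.ValiantsHypothesis.ValiantsHypothesis.Theorems.BarrierLeverDefinableEquations.razSlots n b) → ℂ, Literature.Computability.AlgebraicComplexity.RazUniversal.outVal y ∈ Literature.Barriers.ValiantsHypothesis.SmallCircuits ℂ n (2 * b + 9) :=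
  fun _ _ hn y => RazImage.outVal_mem hn y

end Summit.ValiantsHypothesis.ValiantsHypothesis.Theorems.BarrierLeverDefinableEquations

end
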